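/-
Origin: expansion seat `planner-pub-hodgecm-mc-axioms-1-g14-0`, handover #W15 2026-08-20T15:53:55Z md5 f03efefa5ba8 (PKG 4d16cf18fddf → f03efefa5ba8; 246 l.; MECHANICAL (iib-R) rewrite v3.1 of the PKG file as it stands (30 token edits; rules R1x1+R2x1+RX[h₂']x6+R3x2+R8x20)) (`HOME/mc/pub-hodgecm-mc-axioms-1-g14/revendor/kit-r55/stage55/HodgeCM/Model/UisoOfCommonReflex.lean`, md5 f03efefa5ba8, 246 lines);
landed by the gen-22 packager (p-g22) in gate run 55 REPLACES the earlier landed copy of `HodgeCM/Model/UisoOfCommonReflex.lean` (seat copy carried the packager Origin header of an earlier run (stripped)).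
-/
/-
Copyright (c) 2026 the pub-hodgecm formalisation cell (harness21).  New file, not vendored.
Origin: HOME/mc/pub-hodgecm-mc-axioms-1-g12/lean/jliu/HodgeCM/Model/UisoOfCommonReflex.lean — session
planner-pub-hodgecm-mc-axioms-1-g12-0 (unit pub-hodgecm-mc-axioms-1-g12, CONSTRUCTION PROVER gen 12 of lineage mc-axioms-1,
node N-i1 (L-lvl)), 2026-08-20.  Intended final place: `HodgeCM/Model/UisoOfCommonReflex.lean` (NEW additive MODEL leaf;
imports `HodgeCM.CM.CommonReflexSpan` (L2) and `HodgeCM.Model.UniverseCM` (M13 `fact_alphaLine`)).  (J-Liu-iso) JUNCTION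
KERNEL of the axioms-1-g10 design memo `HOME/mc/pub-hodgecm-mc-axioms-1-g10/notes/J-Liu-iso-memo.md` §3 (route R-down),
read ON THE MODEL UNIVERSE: the step from «a class is a sum of pull-backs of CM eigen-forms of a common-reflex abelian
variety `A`» to «the class lies in `Universe.Uiso Γ K Ψ σ`».
-/
import Summits.HodgeConjecture.HodgeCM.CM.CommonReflexSpan_2
import Summits.HodgeConjecture.HodgeCM.Model.UniverseCM

set_option autoImplicit false

/-!
# Pull-backs of common-reflex CM eigen-forms lie in the isotypic block `Uiso`

KERNEL over the universe's rows `hHD`, `hI`, (ii) `BallQuotientUniformisedDatum`, (iii) `CMAbelianVarietyRealised` and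
Riemann's fullness `hR : DeligneMilne1982_Thm_6_20_full` (node-E binder, P).  Two statements:

* `HodgeCM.CM.CommonReflex.eigenline_le_span_pull_eigenline_coded` — (L2) of `CommonReflexSpan` with the target
  realisation `B` given over a CODE FIELD `e₁ : K ≃+* E₁` (as the universe's `cmAV K Ψ` is: `cmRealisation h₃ (cmCode K Ψ)`
  acts through `(cmCode K Ψ).E ≃ K`), and both CM types given by membership clauses relative to the base pair
  `(M', Φ')` (`τ ∈ Φ₁ ↔ τ ∘ e₁ ∘ k₁ ∈ Φ'`, `τ ∈ Φ_A ↔ τ ∘ k₂ ∈ Φ'`) instead of literal `inducedCMType` equations;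
  the `K`-indexed action on `H¹(B)` is `cmAction (θ₁ ∘ e₁)` (`cmAction_comp_ringEquiv`).

* `HodgeCM.Model.universeOf_span_pull_eigenline_le_Uiso` / `Model.span_pull_eigenline_le_Uiso` — ON THE MODEL
  UNIVERSE `U = universeOf hHD hI hU h₃` / `picardCMUniverse hHD hI h₁ h₃`: for a CM field `K`, a CM type `Ψ` of `K`
  and `σ ∈ Ψ`, a CM pair `(M', Φ')` with `k₁ : M' → K` inflating `Φ'` to `Ψ`, a number field `M` with `k₂ : M' → M`, an
  abelian variety `A` realising the `k₂`-inflated type, and `τ : M → ℂ` with `τ ∘ k₂ = σ ∘ k₁`: the `ℂ`-span of the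
  classes `(f^*)_ℂ α` on the surface `U.pms L ι₁ V Γ` — `f` a morphism from THE realised surface to `A`, `α` in the
  `τ`-eigenline of `ℂ ⊗ H¹(A; ℚ)` — is contained in `U.Uiso Γ K Ψ σ`.

Proof of the second: a generator `(f^*)_ℂ α` has `α = Σ_j d_j (u_j^*)_ℂ β_j` with `u_j : A → A_{(K,Ψ)}` and `β_j` in the
`σ`-eigenline of the universe's CM action (first statement, with `C` a realisation of `(M', Φ')` taken from record (iii)
itself); that eigenline IS `U.eigenLine K Ψ σ` (by `rfl`: `CommonReflex.eigenline_complexify_eq`, `BettiUniverse.cmEndAction_ι`)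
`= U.alphaLine K Ψ σ` (M13 `fact_alphaLine`, `σ ∈ Ψ`), and `(f^*)_ℂ (u_j^*)_ℂ β_j = U.pullC (f ≫ u_j) 1 β_j`
(`BettiUniverse.pull_comp`).

USE.  This is the whole MODEL side of the (J-Liu-iso) junction for E's binder `hsmall` (route R-down: `M := c.K`,
`k := id`, `σ' := c.σ`, `inflate (RingHom.id _) Ψ = Ψ`): what remains is CONTENT — Liu's `A_μ` as a realisation of a
`k₂`-inflated type (memo (I1)) and the theta classes of `Theta V c i Γ` as sums of pull-backs `(f^*)_ℂ α` along maps
from the realised surface (memo (I2); [Liu21, Thm. 4.18 and its proof, (4.3)]) — inputs of the future consumer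
`Model/HLiuOfRecord.lean`, not of this file.  Nothing of PerL / [QW8] / the 2001 programme is used or asserted.
-/

noncomputable section

open scoped TensorProduct
open NumberField CategoryTheory Module

/-! ## 1. (L2) with a coded target realisation -/

namespace HodgeCM.CM.CommonReflex

open Literature.AlgebraicGeometry.Motives (SchemeOver IsSmoothProjective CMType AbelianVariety bettiCohomology)
open Literature.AlgebraicGeometry.HodgeTheory (complexBetti hodgePQ_independent_of_hodgeModel
  DeligneMilne1982_Thm_6_20_full)
open Literature.AlgebraicGeometry.HodgeTheory.BettiUniverse (pull pull_comp cmAction IsInducedOnIntegers)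
open Literature.AlgebraicGeometry.ComplexMultiplication
open Literature.NumberTheory.Automorphic.PicardCM (eigenline)
open Literature.NumberTheory.ComplexMultiplication (inducedCMType mem_inducedCMType_iff)

section Coded

variable {M' K M E₁ : Type} [Field M'] [NumberField M'] [Field K] [NumberField K] [Field M] [NumberField M]
  [Field E₁] [NumberField E₁] {Φ' : CMType M'}
  {C : AbelianVariety ℂ} {ιC : 𝓞 M' →+* End C} {θC : M' →+* Module.End ℂ (complexBetti C.X 1)}
  {B : AbelianVariety ℂ} {ι₁ : 𝓞 E₁ →+* End B} {θ₁ : E₁ →+* Module.End ℂ (complexBetti B.X 1)}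
  {A : AbelianVariety ℂ} {ιA : 𝓞 M →+* End A} {θA : M →+* Module.End ℂ (complexBetti A.X 1)}

/-- **(L2) with the target realisation over a code field.**  `k₁ : M' → K`, `k₂ : M' → M`; `e₁ : K ≃+* E₁` a code
field of `K` with a realisation `(B, ι₁, θ₁)` of the CM type `Φ₁` of `E₁` corresponding to `Φ'^K` (`τ ∈ Φ₁ ↔
τ ∘ e₁ ∘ k₁ ∈ Φ'`); `(A, ι_A, θ_A)` a realisation of a CM type `Φ_A` of `M` corresponding to `Φ'^M` (`τ ∈ Φ_A ↔ τ ∘ k₂ ∈ Φ'`);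
`(C, ι_C, θ_C)` a realisation of `(M', Φ')`.  If `τ ∘ k₂ = σ ∘ k₁` then the `τ`-eigenline of `ℂ ⊗ H¹(A; ℚ)` lies in the
span of the pull-backs `(u^*)_ℂ β`, `u : A → B`, of `σ`-eigenvectors `β` of the `K`-action `cmAction (θ₁ ∘ e₁)` on
`ℂ ⊗ H¹(B; ℚ)`. [folklore] -/
theorem eigenline_le_span_pull_eigenline_coded (k₁ : M' →+* K) (k₂ : M' →+* M)
    (hR : DeligneMilne1982_Thm_6_20_full) (hI : hodgePQ_independent_of_hodgeModel)
    (hC : IsCMTypeRealisation Φ' C ιC θC)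
    (e₁ : K ≃+* E₁) {Φ₁ : CMType E₁}
    (hΦ₁ : ∀ τ : E₁ →+* ℂ, τ ∈ Φ₁.1 ↔ (τ.comp e₁.toRingHom).comp k₁ ∈ Φ'.1)
    (hB : IsCMTypeRealisation Φ₁ B ι₁ θ₁) (hθ₁ : IsInducedOnIntegers (θ₁.comp e₁.toRingHom))
    {ΦA : CMType M} (hΦA : ∀ τ : M →+* ℂ, τ ∈ ΦA.1 ↔ τ.comp k₂ ∈ Φ'.1)
    (hA : IsCMTypeRealisation ΦA A ιA θA) (hθA : IsInducedOnIntegers θA)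
    {σ : K →+* ℂ} {τ : M →+* ℂ} (hστ : τ.comp k₂ = σ.comp k₁) :
    eigenline (complexify (cmAction θA hθA)) τ ≤
      Submodule.span ℂ {x | ∃ (u : A.X ⟶ B.X) (β : ℂ ⊗[ℚ] bettiCohomology B.X 1),
        β ∈ eigenline (complexify (cmAction (θ₁.comp e₁.toRingHom) hθ₁)) σ ∧ x = (pull u 1).baseChange ℂ β} := by
  -- move `k₁` to the code field: `Φ₁ = Φ'^{E₁}` along `e₁ ∘ k₁`, `Φ_A = Φ'^M` along `k₂`
  have hΦ₁' : Φ₁ = inducedCMType (e₁.toRingHom.comp k₁) Φ' := by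
    apply Subtype.ext
    ext τ'
    rw [hΦ₁, mem_inducedCMType_iff, RingHom.comp_assoc]
  have hΦA' : ΦA = inducedCMType k₂ Φ' := by
    apply Subtype.ext
    ext τ'
    rw [hΦA, mem_inducedCMType_iff]
  have hB' : IsCMTypeRealisation (inducedCMType (e₁.toRingHom.comp k₁) Φ') B ι₁ θ₁ := by
    rw [← hΦ₁']; exact hB
  have hA' : IsCMTypeRealisation (inducedCMType k₂ Φ') A ιA θA := by
    rw [← hΦA']; exact hA
  have hστ' : τ.comp k₂ = (σ.comp e₁.symm.toRingHom).comp (e₁.toRingHom.comp k₁) := by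
    rw [hστ]
    ext x
    simp
  refine (eigenline_le_span_pull_eigenline (e₁.toRingHom.comp k₁) k₂ hR hI hC hB' hA'
    hC.isInducedOnIntegers hB.isInducedOnIntegers hθA hστ').trans (Submodule.span_mono ?_)
  rintro x ⟨u, β, hβ, rfl⟩
  refine ⟨u, β, ?_, rfl⟩
  rw [mem_eigenline_complexify_iff] at hβ ⊢
  intro a
  rw [cmAction_comp_ringEquiv θ₁ hB.isInducedOnIntegers e₁ hθ₁ a, hβ (e₁ a)]
  simp

end Coded

end HodgeCM.CM.CommonReflex

/-! ## 2. On the model universe -/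

namespace HodgeCM

open Literature.AlgebraicGeometry.Motives (CMType)

/-- A generator of `Uiso`: the pull-back `U.pullC F 1 α` of a holomorphic `σ`-eigen one-form `α ∈ U.alphaLine K Ψ σ`
along a morphism `F : P_Γ → A_{(K,Ψ)}` lies in `U.Uiso Γ K Ψ σ` (by definition of the span). [folklore] -/
theorem Universe.pullC_alphaLine_mem_Uiso (U : Universe) {L : CMField} {ι₁ : L →+* ℂ} {V : HermSpace3 L ι₁}
    (Γ : Level V) (K : CMField) (Ψ : CMType K) (σ : K →+* ℂ) (F : U.Mor (U.pms L ι₁ V Γ) (U.cmAV K Ψ))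
    {α : U.CohC (U.cmAV K Ψ) 1} (hα : α ∈ U.alphaLine K Ψ σ) : U.pullC F 1 α ∈ U.Uiso Γ K Ψ σ :=
  Submodule.subset_span ⟨F, α, hα, rfl⟩

namespace Model

open Literature.AlgebraicGeometry.Motives (CMType AbelianVariety bettiCohomology)
open Literature.AlgebraicGeometry.HodgeTheory
open Literature.AlgebraicGeometry.HodgeTheory.BettiUniverse (pull pull_comp cmAction IsInducedOnIntegers)
open Literature.AlgebraicGeometry.ComplexMultiplication (IsCMTypeRealisation)
open Literature.NumberTheory.Automorphic.PicardCM
open HodgeCM.CM.CommonReflex (complexify eigenline_le_span_pull_eigenline_coded)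

variable (hHD : exists_isReal_hodgeModel) (hI : hodgePQ_independent_of_hodgeModel)
variable (hU : Literature.NumberTheory.Automorphic.PicardCM.BallQuotientUniformisedDatum)
  (h₃ : Literature.NumberTheory.Automorphic.PicardCM.CMAbelianVarietyRealised)

/-- **Pull-backs of common-reflex CM eigen-forms lie in `Uiso`** (model universe `universeOf hHD hI hU h₃`).
`K` a CM field with CM type `Ψ`, `σ ∈ Ψ`; `(M', Φ')` a CM pair with `k₁ : M' → K` and `Ψ = Φ'^K`
(`τ ∈ Ψ ↔ τ ∘ k₁ ∈ Φ'`); `M` a number field with `k₂ : M' → M`, `Φ_A = Φ'^M`, `(A, ι_A, θ_A)` a realisation of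
`(M; Φ_A)`; `τ : M → ℂ` with `τ ∘ k₂ = σ ∘ k₁`.  Then every `ℂ`-combination of classes `(f^*)_ℂ α` on the realised surface
`U.pms L ι₁ V Γ` — `f` a morphism of the realised surface to `A`, `α` a `τ`-eigenvector of `ℂ ⊗ H¹(A; ℚ)` — lies in
`U.Uiso Γ K Ψ σ`.  Inputs beyond the universe's rows: Riemann's fullness `hR`. [folklore] -/
theorem universeOf_span_pull_eigenline_le_Uiso
    {L : CMField} {ι₁ : L →+* ℂ} (V : HermSpace3 L ι₁) (Γ : Level V)
    (K : CMField) (Ψ : CMType K) {σ : K →+* ℂ} (hσ : σ ∈ Ψ.1)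
    {M' : Type} [Field M'] [NumberField M'] [IsCMField M'] {Φ' : CMType M'} (k₁ : M' →+* K)
    (hΨ : ∀ τ : K →+* ℂ, τ ∈ Ψ.1 ↔ τ.comp k₁ ∈ Φ'.1)
    {M : Type} [Field M] [NumberField M] (k₂ : M' →+* M) {ΦA : CMType M}
    (hΦA : ∀ τ : M →+* ℂ, τ ∈ ΦA.1 ↔ τ.comp k₂ ∈ Φ'.1)
    {A : AbelianVariety ℂ} {ιA : 𝓞 M →+* End A} {θA : M →+* Module.End ℂ (complexBetti A.X 1)}
    (hA : IsCMTypeRealisation ΦA A ιA θA) (hθA : IsInducedOnIntegers θA)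
    (hR : DeligneMilne1982_Thm_6_20_full)
    {τ : M →+* ℂ} (hστ : τ.comp k₂ = σ.comp k₁) :
    Submodule.span ℂ {x : (universeOf hHD hI hU h₃).CohC ((universeOf hHD hI hU h₃).pms L ι₁ V Γ) 1 |
        ∃ (f : (pmsRealisation hU (pmsCode L ι₁ V Γ)).X ⟶ A.X) (α : ℂ ⊗[ℚ] bettiCohomology A.X 1),
          α ∈ eigenline (complexify (cmAction θA hθA)) τ ∧ x = (pull f 1).baseChange ℂ α}
      ≤ (universeOf hHD hI hU h₃).Uiso Γ K Ψ σ := by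
  -- a realisation `C` of the base pair, from record (iii) itself
  obtain ⟨C, ιC, θC, hC⟩ := h₃ M' Φ'
  have hC' : IsCMTypeRealisation Φ' C ιC θC := hC
  -- the universe's `A_{(K,Ψ)}`: the chosen realisation of the code, acting through `cmCodeEquiv K Ψ`
  have hB : IsCMTypeRealisation (cmCode K Ψ).Φ (cmRealisation h₃ (cmCode K Ψ)).AV
      (cmRealisation h₃ (cmCode K Ψ)).ι (cmRealisation h₃ (cmCode K Ψ)).θ :=
    ⟨(cmRealisation h₃ _).isSmoothProjective, (cmRealisation h₃ _).finrank_eq, (cmRealisation h₃ _).map_ι,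
      fun σ' ↦ ⟨(cmRealisation h₃ _).finrank_eigenline σ', (cmRealisation h₃ _).hodgeType_of_mem σ',
        (cmRealisation h₃ _).hodgeType_of_not_mem σ'⟩⟩
  have hΦ₁ : ∀ τ' : (cmCode K Ψ).E →+* ℂ,
      τ' ∈ (cmCode K Ψ).Φ.1 ↔ (τ'.comp (cmCodeEquiv K Ψ).toRingHom).comp k₁ ∈ Φ'.1 :=
    fun τ' ↦ (show τ' ∈ (cmCode K Ψ).Φ.1 ↔ τ'.comp (cmCodeEquiv K Ψ).toRingHom ∈ Ψ.1 from Iff.rfl).trans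
      (hΨ _)
  have hle := eigenline_le_span_pull_eigenline_coded k₁ k₂ hR hI hC' (cmCodeEquiv K Ψ) hΦ₁ hB
    ((cmRealisation h₃ (cmCode K Ψ)).exists_map_comp (cmCodeEquiv K Ψ)) hΦA hA hθA hστ
  rw [Submodule.span_le]
  rintro x ⟨f, α, hα, rfl⟩
  have key : Submodule.map ((pull f 1).baseChange ℂ)
      (Submodule.span ℂ {x | ∃ (u : A.X ⟶ (cmRealisation h₃ (cmCode K Ψ)).AV.X)
        (β : ℂ ⊗[ℚ] bettiCohomology (cmRealisation h₃ (cmCode K Ψ)).AV.X 1),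
        β ∈ eigenline (complexify (cmAction ((cmRealisation h₃ (cmCode K Ψ)).θ.comp
          (cmCodeEquiv K Ψ).toRingHom) ((cmRealisation h₃ (cmCode K Ψ)).exists_map_comp (cmCodeEquiv K Ψ)))) σ ∧
        x = (pull u 1).baseChange ℂ β}) ≤ (universeOf hHD hI hU h₃).Uiso Γ K Ψ σ := by
    rw [Submodule.map_span_le]
    rintro m ⟨u, β, hβ, rfl⟩
    -- `β ∈ U.alphaLine K Ψ σ = U.eigenLine K Ψ σ` (M13, `σ ∈ Ψ`), and `U.eigenLine K Ψ σ` IS this eigenline (`rfl`)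
    have hβ' : (β : (universeOf hHD hI hU h₃).CohC ((universeOf hHD hI hU h₃).cmAV K Ψ) 1) ∈
        (universeOf hHD hI hU h₃).alphaLine K Ψ σ := by
      rw [((universeOf_fact_alphaLine hHD hI hU h₃) K Ψ σ).1 hσ]
      exact hβ
    -- the composite AS a morphism `P_Γ → A_{(K,Ψ)}` of the universe (`U.Mor _ _` unfolds to the scheme morphisms, `rfl`)
    let F : (universeOf hHD hI hU h₃).Mor ((universeOf hHD hI hU h₃).pms L ι₁ V Γ)
        ((universeOf hHD hI hU h₃).cmAV K Ψ) := f ≫ u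
    have hgen := Universe.pullC_alphaLine_mem_Uiso (universeOf hHD hI hU h₃) Γ K Ψ σ F hβ'
    -- `(f^*)_ℂ ((u^*)_ℂ β) = ((f ≫ u)^*)_ℂ β = U.pullC F 1 β`
    have heq : ((pull f 1).baseChange ℂ) (((pull u 1).baseChange ℂ) β) =
        (universeOf hHD hI hU h₃).pullC F 1 β := by
      show _ = (pull (f ≫ u) 1).baseChange ℂ β
      rw [pull_comp, LinearMap.baseChange_comp]
      rfl
    rw [heq]
    exact hgen
  exact key (Submodule.mem_map_of_mem (hle hα))

section PicardCM

variable (h₁ : BallQuotientUniformised)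

/-- The same on the end-state universe `picardCMUniverse hHD hI h₁ h₃` (node-E shape). [folklore] -/
theorem span_pull_eigenline_le_Uiso
    {L : CMField} {ι₁ : L →+* ℂ} (V : HermSpace3 L ι₁) (Γ : Level V)
    (K : CMField) (Ψ : CMType K) {σ : K →+* ℂ} (hσ : σ ∈ Ψ.1)
    {M' : Type} [Field M'] [NumberField M'] [IsCMField M'] {Φ' : CMType M'} (k₁ : M' →+* K)
    (hΨ : ∀ τ : K →+* ℂ, τ ∈ Ψ.1 ↔ τ.comp k₁ ∈ Φ'.1)
    {M : Type} [Field M] [NumberField M] (k₂ : M' →+* M) {ΦA : CMType M}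
    (hΦA : ∀ τ : M →+* ℂ, τ ∈ ΦA.1 ↔ τ.comp k₂ ∈ Φ'.1)
    {A : AbelianVariety ℂ} {ιA : 𝓞 M →+* End A} {θA : M →+* Module.End ℂ (complexBetti A.X 1)}
    (hA : IsCMTypeRealisation ΦA A ιA θA) (hθA : IsInducedOnIntegers θA)
    (hR : DeligneMilne1982_Thm_6_20_full)
    {τ : M →+* ℂ} (hστ : τ.comp k₂ = σ.comp k₁) :
    Submodule.span ℂ {x : (picardCMUniverse hHD hI h₁ h₃).CohC
        ((picardCMUniverse hHD hI h₁ h₃).pms L ι₁ V Γ) 1 |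
        ∃ (f : (pmsRealisation (ballQuotientUniformisedDatum_of h₁) (pmsCode L ι₁ V Γ)).X ⟶ A.X)
          (α : ℂ ⊗[ℚ] bettiCohomology A.X 1),
          α ∈ eigenline (complexify (cmAction θA hθA)) τ ∧ x = (pull f 1).baseChange ℂ α}
      ≤ (picardCMUniverse hHD hI h₁ h₃).Uiso Γ K Ψ σ :=
  universeOf_span_pull_eigenline_le_Uiso hHD hI _ h₃ V Γ K Ψ hσ k₁ hΨ k₂ hΦA hA hθA hR hστ

end PicardCM

end Model

end HodgeCM

end
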